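import Summits.NavierStokesRegularity.FluidComputer.SmoothedHillVortexField
import Literature.Analysis.FluidPDE.Vorticity
import Mathlib.Analysis.SpecialFunctions.Trigonometric.Deriv
import HarnessLib

/-!
# The smoothed Hill spherical vortex, VII: the circulation of a meridional core loop

Cell `ns-blowup`, seat `ns-blowup-fc-prover-3` (g6); sequel of `SmoothedHillVortexField` (IV).
LABEL: kinematics (a closed curve and one line integral; no named fact). WHAT THIS IS NOT: not NS
evidence — the CORE-LOOP clause of the register's letter (`Letter S 1 v`: a `C¹` closed loop in a
`1/N₁`-ball with circulation `≥ c₁ N₁^{β−2}`), evaluated for the explicit LAZY ENVELOPE SLICE of the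
negative lane of crux `HeredityAtOne` (stmt-NavierStokesRegularity-19249).

The loop is the meridional circle `γ(σ) = (c₀ + r₀ cos 2πσ, 0, −r₀ sin 2πσ)` (centre `(c₀, 0, 0)`,
radius `r₀`, in the plane `x₁ = 0`, oriented so that the flux of `ω = M(−x₁, x₀, 0)` through it is
positive). Inside the Hill core (`(c₀ + r₀)² ≤ a²`) the field is the explicit polynomial core of IV, and
the circulation is computed by the fundamental theorem of calculus on an explicit primitive:

* `coreLoop`, `hasDerivAt_coreLoop`, `contDiff_coreLoop`, `coreLoop_zero_eq_one`,
  `coreLoop_mem_closedBall` (radius `r₀` about the centre), `norm_deriv_coreLoop` (`= 2π r₀`),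
  `rsq_coreLoop_le` (`|γ|² ≤ (c₀ + r₀)²`);
* **`circulation_hillField_coreLoop`**: `∮_γ u · dγ = M π c₀ r₀²` — Stokes by hand: the flux of the
  constant-quotient vorticity `ω₁ = M x₀` through the disc.

References: M. J. M. Hill, Phil. Trans. R. Soc. London A 185 (1894) 213–245 [cite: Hill1894, Art. 1–4];
A. J. Majda, A. L. Bertozzi, *Vorticity and Incompressible Flow* (CUP 2002), Prop. 1.11 (i),
eq. (1.57) (circulation) [cite: MajdaBertozziCUP2002, Prop. 1.11 (i) eq. (1.57)].
-/

noncomputable section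

open Real Set Function MeasureTheory intervalIntegral
open scoped ContDiff RealInnerProductSpace

namespace Summit.NavierStokesRegularity.FluidComputer

namespace SmoothedHill

open Literature.Analysis.FluidPDE

variable {M a b c₀ r₀ : ℝ}

/-! ## The loop -/

/-- **The meridional core loop**: the circle of radius `r₀` about `(c₀, 0, 0)` in the plane
`x₁ = 0`, `γ(σ) = (c₀ + r₀ cos 2πσ, 0, −r₀ sin 2πσ)`, parametrised by `[0, 1]`. [folklore] -/
def coreLoop (c₀ r₀ : ℝ) (σ : ℝ) : EuclideanSpace ℝ (Fin 3) :=
  !₂[c₀ + r₀ * Real.cos (2 * π * σ), 0, -(r₀ * Real.sin (2 * π * σ))]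

/-- Expansion in the standard basis. [folklore] -/
theorem coreLoop_eq (c₀ r₀ σ : ℝ) : coreLoop c₀ r₀ σ =
    (c₀ + r₀ * Real.cos (2 * π * σ)) • EuclideanSpace.single (0 : Fin 3) (1 : ℝ) +
      (-(r₀ * Real.sin (2 * π * σ))) • EuclideanSpace.single (2 : Fin 3) (1 : ℝ) := by
  ext i; fin_cases i <;> simp [coreLoop]

/-- The velocity of the loop. [folklore] -/
theorem hasDerivAt_coreLoop (c₀ r₀ σ : ℝ) : HasDerivAt (coreLoop c₀ r₀)
    ((-(2 * π * r₀ * Real.sin (2 * π * σ))) • EuclideanSpace.single (0 : Fin 3) (1 : ℝ) +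
      (-(2 * π * r₀ * Real.cos (2 * π * σ))) • EuclideanSpace.single (2 : Fin 3) (1 : ℝ)) σ := by
  have e : coreLoop c₀ r₀ = fun σ => (c₀ + r₀ * Real.cos (2 * π * σ)) •
      EuclideanSpace.single (0 : Fin 3) (1 : ℝ) +
      (-(r₀ * Real.sin (2 * π * σ))) • EuclideanSpace.single (2 : Fin 3) (1 : ℝ) :=
    funext (coreLoop_eq c₀ r₀)
  rw [e]
  have hθ : HasDerivAt (fun σ : ℝ => 2 * π * σ) (2 * π) σ := by
    simpa using (hasDerivAt_id σ).const_mul (2 * π)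
  have hcos := ((Real.hasDerivAt_cos _).comp σ hθ).const_mul r₀ |>.const_add c₀
  have hsin := (((Real.hasDerivAt_sin _).comp σ hθ).const_mul r₀).neg
  have h := (hcos.smul_const (EuclideanSpace.single (0 : Fin 3) (1 : ℝ))).add
    (hsin.smul_const (EuclideanSpace.single (2 : Fin 3) (1 : ℝ)))
  refine h.congr_deriv ?_
  ext i
  fin_cases i <;> simp <;> ring

/-- The derivative of the loop. [folklore] -/
theorem deriv_coreLoop (c₀ r₀ σ : ℝ) : deriv (coreLoop c₀ r₀) σ =
    (-(2 * π * r₀ * Real.sin (2 * π * σ))) • EuclideanSpace.single (0 : Fin 3) (1 : ℝ) +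
      (-(2 * π * r₀ * Real.cos (2 * π * σ))) • EuclideanSpace.single (2 : Fin 3) (1 : ℝ) :=
  (hasDerivAt_coreLoop c₀ r₀ σ).deriv

/-- The loop is smooth. [folklore] -/
theorem contDiff_coreLoop (c₀ r₀ : ℝ) {n : WithTop ℕ∞} : ContDiff ℝ n (coreLoop c₀ r₀) := by
  have e : coreLoop c₀ r₀ = fun σ => (c₀ + r₀ * Real.cos (2 * π * σ)) •
      EuclideanSpace.single (0 : Fin 3) (1 : ℝ) +
      (-(r₀ * Real.sin (2 * π * σ))) • EuclideanSpace.single (2 : Fin 3) (1 : ℝ) :=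
    funext (coreLoop_eq c₀ r₀)
  rw [e]
  have hθ : ContDiff ℝ n (fun σ : ℝ => 2 * π * σ) := contDiff_const.mul contDiff_id
  exact ((contDiff_const.add (contDiff_const.mul (Real.contDiff_cos.comp hθ))).smul
    contDiff_const).add ((contDiff_const.mul (Real.contDiff_sin.comp hθ)).neg.smul contDiff_const)

/-- The loop is closed: `γ 0 = γ 1`. [folklore] -/
theorem coreLoop_zero_eq_one (c₀ r₀ : ℝ) : coreLoop c₀ r₀ 0 = coreLoop c₀ r₀ 1 := by
  simp [coreLoop]

/-- The loop stays on the circle of radius `|r₀|` about its centre `(c₀, 0, 0)`; in particular in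
the closed ball of that radius. [folklore] -/
theorem coreLoop_mem_closedBall (c₀ r₀ σ : ℝ) :
    coreLoop c₀ r₀ σ ∈ Metric.closedBall (!₂[c₀, 0, 0] : EuclideanSpace ℝ (Fin 3)) |r₀| := by
  rw [Metric.mem_closedBall, dist_eq_norm, EuclideanSpace.norm_eq, Fin.sum_univ_three]
  simp only [coreLoop, PiLp.sub_apply, Matrix.cons_val_zero, Matrix.cons_val_one,
    Matrix.cons_val_two, Matrix.tail_cons, Matrix.head_cons, Real.norm_eq_abs, sq_abs]
  have h : (c₀ + r₀ * Real.cos (2 * π * σ) - c₀) ^ 2 + (0 - 0) ^ 2 +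
      (-(r₀ * Real.sin (2 * π * σ)) - 0) ^ 2 = r₀ ^ 2 := by
    linear_combination r₀ ^ 2 * Real.sin_sq_add_cos_sq (2 * π * σ)
  rw [h, Real.sqrt_sq_eq_abs]

/-- The speed of the loop is `2π |r₀|`. [folklore] -/
theorem norm_deriv_coreLoop (c₀ r₀ σ : ℝ) : ‖deriv (coreLoop c₀ r₀) σ‖ = 2 * π * |r₀| := by
  rw [deriv_coreLoop, EuclideanSpace.norm_eq, Fin.sum_univ_three]
  simp only [PiLp.add_apply, PiLp.smul_apply, PiLp.single_apply, smul_eq_mul,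
    Real.norm_eq_abs, sq_abs]
  simp only [Fin.isValue, ↓reduceIte, mul_one, Fin.reduceEq, mul_zero, add_zero, zero_add]
  have h : (-(2 * π * r₀ * Real.sin (2 * π * σ))) ^ 2 + (0:ℝ) ^ 2 +
      (-(2 * π * r₀ * Real.cos (2 * π * σ))) ^ 2 = (2 * π * r₀) ^ 2 := by
    linear_combination (2 * π * r₀) ^ 2 * Real.sin_sq_add_cos_sq (2 * π * σ)
  rw [h, Real.sqrt_sq_eq_abs, abs_mul, abs_of_pos (by positivity : (0:ℝ) < 2 * π)]

/-- The loop stays in the ball `|x|² ≤ (c₀ + r₀)²` about the origin (`0 ≤ c₀`, `0 ≤ r₀`).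
[folklore] -/
theorem rsq_coreLoop_le (hc : 0 ≤ c₀) (hr : 0 ≤ r₀) (σ : ℝ) :
    rsq (coreLoop c₀ r₀ σ) ≤ (c₀ + r₀) ^ 2 := by
  simp only [rsq, coreLoop, PiLp.toLp_apply, Matrix.cons_val_zero, Matrix.cons_val_one,
    Matrix.cons_val_two, Matrix.tail_cons, Matrix.head_cons]
  have hcos := Real.cos_le_one (2 * π * σ)
  have hss := Real.sin_sq_add_cos_sq (2 * π * σ)
  have key : (c₀ + r₀ * Real.cos (2 * π * σ)) ^ 2 + (0:ℝ) ^ 2 + (-(r₀ * Real.sin (2 * π * σ))) ^ 2 =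
      c₀ ^ 2 + 2 * (c₀ * r₀) * Real.cos (2 * π * σ) + r₀ ^ 2 := by
    linear_combination r₀ ^ 2 * hss
  rw [key]
  nlinarith [mul_le_mul_of_nonneg_left hcos (mul_nonneg hc hr)]

/-! ## The circulation -/

/-- **The circulation of the smoothed Hill vortex around the meridional core loop is
`M π c₀ r₀²`** (`0 < a < b`, `0 ≤ c₀`, `0 ≤ r₀`, `(c₀ + r₀)² ≤ a²` so that the loop lies in the Hill
core): the flux of `ω = M(−x₁, x₀, 0)` through the disc, computed as a line integral by the
fundamental theorem of calculus. [cite: MajdaBertozziCUP2002, Prop. 1.11 (i) eq. (1.57)] -/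
theorem circulation_hillField_coreLoop (ha : 0 < a) (hab : a < b) (hc : 0 ≤ c₀) (hr : 0 ≤ r₀)
    (hcore : (c₀ + r₀) ^ 2 ≤ a ^ 2) :
    circulation (hillField M a b) (coreLoop c₀ r₀) = M * π * c₀ * r₀ ^ 2 := by
  -- the integrand as an explicit trigonometric polynomial
  set g₀ := potential M a b 0 with hg₀
  set F : ℝ → ℝ := fun σ =>
    M / 5 * (c₀ + r₀ * Real.cos (2 * π * σ)) * (-(r₀ * Real.sin (2 * π * σ))) *
        (-(2 * π * r₀ * Real.sin (2 * π * σ))) +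
      (2 * g₀ - M / 5 * (2 * (c₀ + r₀ * Real.cos (2 * π * σ)) ^ 2 +
        (-(r₀ * Real.sin (2 * π * σ))) ^ 2)) * (-(2 * π * r₀ * Real.cos (2 * π * σ))) with hF
  have hint : ∀ σ, ⟪hillField M a b (coreLoop c₀ r₀ σ), deriv (coreLoop c₀ r₀) σ⟫ = F σ := by
    intro σ
    have hx : rsq (coreLoop c₀ r₀ σ) ≤ a ^ 2 := (rsq_coreLoop_le hc hr σ).trans hcore
    rw [hillField_of_core ha hab hx, deriv_coreLoop]
    simp only [coreLoop, PiLp.inner_apply, Fin.sum_univ_three, PiLp.add_apply, PiLp.smul_apply,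
      PiLp.single_apply, PiLp.toLp_apply, Matrix.cons_val_zero, Matrix.cons_val_one,
      Matrix.cons_val_two, Matrix.tail_cons, Matrix.head_cons, RCLike.inner_apply, conj_trivial,
      smul_eq_mul]
    simp only [Fin.isValue, ↓reduceIte, mul_one, Fin.reduceEq, mul_zero, add_zero, zero_add, hF]
    ring
  -- an explicit primitive (no `π` in denominators: the `2π` of the chain rule is absorbed)
  set G : ℝ → ℝ := fun σ => π * r₀ ^ 2 * M * c₀ * σ +
      3 * r₀ ^ 2 * M * c₀ / 10 * (Real.sin (2 * π * σ) * Real.cos (2 * π * σ)) +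
      (-(2 * r₀ * g₀) + 2 * r₀ * M * c₀ ^ 2 / 5 + 2 * r₀ ^ 3 * M / 5) * Real.sin (2 * π * σ) with hG
  have hderiv : ∀ σ, HasDerivAt G (F σ) σ := by
    intro σ
    have hθ : HasDerivAt (fun σ : ℝ => 2 * π * σ) (2 * π) σ := by
      simpa using (hasDerivAt_id σ).const_mul (2 * π)
    have hs : HasDerivAt (fun σ : ℝ => Real.sin (2 * π * σ)) (Real.cos (2 * π * σ) * (2 * π)) σ :=
      (Real.hasDerivAt_sin _).comp σ hθ
    have hcs : HasDerivAt (fun σ : ℝ => Real.cos (2 * π * σ)) (-Real.sin (2 * π * σ) * (2 * π)) σ :=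
      (Real.hasDerivAt_cos _).comp σ hθ
    have h1 := (hasDerivAt_id σ).const_mul (π * r₀ ^ 2 * M * c₀)
    have h2 := (hs.mul hcs).const_mul (3 * r₀ ^ 2 * M * c₀ / 10)
    have h3 := hs.const_mul (-(2 * r₀ * g₀) + 2 * r₀ * M * c₀ ^ 2 / 5 + 2 * r₀ ^ 3 * M / 5)
    have h : HasDerivAt G _ σ := (h1.add h2).add h3
    refine h.congr_deriv ?_
    simp only [hF]
    linear_combination (-(π * r₀ ^ 2 * M * c₀ + 4 * π * r₀ ^ 3 * M / 5 * Real.cos (2 * π * σ))) *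
      Real.sin_sq_add_cos_sq (2 * π * σ)
  -- the fundamental theorem of calculus
  have hFc : Continuous F := by
    have hd : ∀ σ, HasDerivAt G (F σ) σ := hderiv
    have : F = deriv G := funext fun σ => ((hd σ).deriv).symm
    rw [hF] ; fun_prop
  rw [circulation, intervalIntegral.integral_congr (fun σ _ => hint σ),
    intervalIntegral.integral_eq_sub_of_hasDerivAt (fun σ _ => hderiv σ) (hFc.intervalIntegrable 0 1)]
  simp only [hG, mul_one, mul_zero, Real.sin_zero, Real.cos_zero]
  rw [show (2 : ℝ) * π = 2 * π from rfl, Real.sin_two_pi]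
  ring

end SmoothedHill

end Summit.NavierStokesRegularity.FluidComputer

end
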